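import Summits.QuantumFields.YangMills.Theorems.IR.AfPincerUcSharpLanesTolerance
import Literature.MathematicalPhysics.QuantumLattice.BalabanRGHaarIterates
import HarnessLib

/-!
# Crux `IR` (stmt-QuantumFields-19354), line `af-pincer-Uc`: the SHORT-CHAIN class `TypChain` IS insertion tolerant
# (owner R109 (3), kernel check commissioned from the LEAD ym-lead-19354-af-pincer g2) — cell-local, measurable, calibrated

Helper module for item `stmt-QuantumFields-19354` (`--supports … --as helper`; it closes nothing).  Owner R109 made
`SharpLanes.InsertionTolerant ρ w θ R ℓ₀ Typ` (p536427) the typed reading OF RECORD of the supplier obligation R107(b) and commissioned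
kernel checks of the candidate classes.  This file types the class of the crux-ideate seat ym-cruxidea-19354-nsc (card
`nsc-revelation-engine-weak-gkr` r2, HOME `Sketch-g2-reveal.lean` §B) over tree objects and PROVES it passes.
* §1 `supNormZ4` (`ℓ∞` norm on `ℤ⁴`; body verbatim = `NonSimplyConnectedLatticeGap.Sketch.siteSupNorm`, re-declared because that module
  imports the `ConvexGribovBody` theses, outside this helper's cone) + triangle inequality, symmetry.
* §2 `HasBadChainAmong ρ θ Pl ℓ U` (plaquettes of `Pl`, all `θ`-bad: `θ ≤ plaqAction`, i.e. the tree's `IsBadPlaquette`; steps `≤ 2` in `ℓ∞`;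
  extent `≥ ℓ`); `TypChain ρ θ w ℓ₀ c := {U | ¬ HasBadChainAmong ρ θ (cellPlaqs w c) ℓ₀ U}` (cruxidea-nsc's class, `innerPlaq = cellPlaqs`).
* §3 `typChain_dependsOn`, `measurableSet_typChain`, `typLocal_typChain`; `one_mem_typChain`; monotonicity.
* §4 loop erasure `exists_injective_chain` (adapted from the NSC route's private lemma of the same name,
  `Theorems/ConvexGribovBodyNonSimplyConnectedLatticeGapStubLongBadChainsRareOfChessboard`).
* §5 **`insertionTolerant_typChain` (PROVED)**: `θg < θb`, `R ≥ 3`, `60·ℓ₁ ≤ ℓ₀` ⇒ `InsertionTolerant ρ w θg R ℓ₁ (TypChain ρ θb w ℓ₀)`.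
  Proof: in a `θb`-bad chain of `V` (= `U` off `P`, `#P ≤ ℓ₁`) a plaquette not touching `P` has its `U`-action; one within a chain step of a
  `P`-touching plaquette lies in the `θg`-clean guard, so it is bad only if it touches `P`; hence no chain plaquette touches `P` (chain bad in
  `U ∈ TypChain`: impossible) or all do, and then loop erasure gives an injective chain among the `≤ 30·#P` plaquettes touching `P`
  (`card_plaquettesTouching_le`), of extent `≤ 2(30ℓ₁ − 1) < 60ℓ₁ ≤ ℓ₀`.  (`60` = crude count `30` × step `2`; the true count `6` would give `12`.)
NOT done here: clause (ii)/(iii) rarity of `TypChain` at the sharp mesh (kernel-uniform Peierls on long bad chains; R109 (4): `ℓ₀ ≥ 6` at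
`b ≍ ξ`) and clause (i) for collars carrying short chains (R107 (c)) — the open content.
HONEST FRAMING: a typed class and one combinatorial lemma around ONE open stub of a CONDITIONAL chain (Track A 0/28 UV); nothing of
weak-coupling mixing or a gap; not Clay.  No `sorry`; axioms ⊆ {propext, Classical.choice, Quot.sound}.
-/

set_option autoImplicit false

noncomputable section

open MeasureTheory
open Literature.MathematicalPhysics.QuantumFieldTheory hiding ZdEdge
open Literature.MathematicalPhysics.QuantumLattice
open Literature.Probability.LatticeModels (Site)
open Summit.QuantumFields.YangMills.Cruxes.IR.Tempered (cellEdges)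
open Summit.QuantumFields.YangMills.Theorems.OddTorusChessboard (cellPlaqs plaqAction plaqAction_congr plaqAction_one
  measurable_plaqAction plaquetteEdges_subset_of_mem_cellPlaqs)

namespace Summit.QuantumFields.YangMills.Cruxes.IR.AfPincerUc.SharpLanes

open Summit.QuantumFields.YangMills.Cruxes.IR.AfPincerUc

/-! ## §1 The `ℓ∞` norm on `ℤ⁴` -/
section SupNorm

/-- `‖x‖∞ = maxᵢ |xᵢ|` of a site of `ℤ⁴`, as a natural number (body verbatim = `NonSimplyConnectedLatticeGap.Sketch.siteSupNorm`;
re-declared to stay inside this helper's import cone). -/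
def supNormZ4 (x : Site 4) : ℕ := Finset.univ.sup fun i => (x i).natAbs

/-- Each coordinate is bounded by the sup-norm. -/
theorem natAbs_apply_le_supNormZ4 (x : Site 4) (i : Fin 4) : (x i).natAbs ≤ supNormZ4 x :=
  Finset.le_sup (f := fun j => (x j).natAbs) (Finset.mem_univ i)

/-- `‖x‖∞ ≤ n` iff every coordinate is at most `n` in absolute value. -/
theorem supNormZ4_le_iff {x : Site 4} {n : ℕ} : supNormZ4 x ≤ n ↔ ∀ i, (x i).natAbs ≤ n := by
  simp [supNormZ4, Finset.sup_le_iff]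

/-- Integer form: `‖x − y‖∞ ≤ n` iff `|xᵢ − yᵢ| ≤ n` for all `i`. -/
theorem supNormZ4_sub_le_iff_abs {x y : Site 4} {n : ℕ} : supNormZ4 (x - y) ≤ n ↔ ∀ i, |x i - y i| ≤ (n : ℤ) := by
  rw [supNormZ4_le_iff]
  refine forall_congr' fun i => ?_
  rw [Pi.sub_apply, ← Int.ofNat_le, Int.natCast_natAbs]

/-- Triangle inequality for the sup-distance. -/
theorem supNormZ4_sub_le (x y z : Site 4) : supNormZ4 (x - z) ≤ supNormZ4 (x - y) + supNormZ4 (y - z) := by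
  rw [supNormZ4_le_iff]
  intro i
  have e : (x - z) i = (x - y) i + (y - z) i := by simp
  rw [e]
  exact (Int.natAbs_add_le _ _).trans
    (add_le_add (natAbs_apply_le_supNormZ4 (x - y) i) (natAbs_apply_le_supNormZ4 (y - z) i))

/-- Symmetry of the sup-distance. -/
theorem supNormZ4_sub_comm (x y : Site 4) : supNormZ4 (x - y) = supNormZ4 (y - x) := by
  unfold supNormZ4
  congr 1
  funext i
  rw [Pi.sub_apply, Pi.sub_apply, ← Int.natAbs_neg, neg_sub]

end SupNorm

/-! ## §2 Bad chains among a plaquette set; the short-chain class of a cell -/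
section Chains

variable {G : Type} [Group G] {N : ℕ} (ρ : G →* Matrix (Fin N) (Fin N) ℂ)

/-- **A `θ`-bad chain of extent `≥ ℓ` among the plaquettes of `Pl`** in the configuration `U`: plaquettes `c 0, …, c k ∈ Pl`, all
`θ`-bad (`θ ≤ plaqAction ρ (c i) U`, i.e. `Re tr ρ(U_{c i}) ≤ N − θ`), consecutive base points within `ℓ∞`-distance `2`, end-to-end
`ℓ∞`-distance `≥ ℓ` (cruxidea-nsc `HasBadChainAmong`, with `IsBadPlaquette ρ θ U p ↔ θ ≤ plaqAction ρ p U`). -/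
def HasBadChainAmong (θ : ℝ) (Pl : Set (ZdPlaquette 4)) (ℓ : ℕ) (U : LGConfig 4 G) : Prop :=
  ∃ (k : ℕ) (c : Fin (k + 1) → ZdPlaquette 4), (∀ i, c i ∈ Pl) ∧ (∀ i, θ ≤ plaqAction ρ (c i) U) ∧
    (∀ i : Fin k, supNormZ4 ((c i.castSucc).1 - (c i.succ).1) ≤ 2) ∧
      ℓ ≤ supNormZ4 ((c 0).1 - (c (Fin.last k)).1)

/-- **`TypChain` — the SHORT-CHAIN class of the cell `c` of the frame `w`** (cruxidea-nsc, R107/R109): NO `θ`-bad chain of extent `≥ ℓ₀`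
among the plaquettes FULLY INSIDE the cell (`cellPlaqs w c`: base point and both shifted corners are cell sites).  Configurations with
any number of isolated short bad chains belong to it. -/
def TypChain (θ : ℝ) (w : Fin 4 → ℤ → ℤ) (ℓ₀ : ℕ) (c : Fin 4 → ℤ) : Set (LGConfig 4 G) :=
  {U | ¬ HasBadChainAmong ρ θ (↑(cellPlaqs w c) : Set (ZdPlaquette 4)) ℓ₀ U}

variable {ρ}

/-- Chains are monotone in the threshold (downward) and the extent (downward). -/
theorem HasBadChainAmong.mono {θ θ' : ℝ} {Pl : Set (ZdPlaquette 4)} {ℓ ℓ' : ℕ} {U : LGConfig 4 G}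
    (h : HasBadChainAmong ρ θ Pl ℓ U) (hθ : θ' ≤ θ) (hℓ : ℓ' ≤ ℓ) : HasBadChainAmong ρ θ' Pl ℓ' U := by
  obtain ⟨k, c, hin, hbad, hstep, hext⟩ := h
  exact ⟨k, c, hin, fun i => hθ.trans (hbad i), hstep, hℓ.trans hext⟩

/-- A chain all of whose plaquettes have the same action in `U` and `V` transfers from `U` to `V`. -/
theorem HasBadChainAmong.congr {θ : ℝ} {Pl : Set (ZdPlaquette 4)} {ℓ : ℕ} {U V : LGConfig 4 G}
    (h : HasBadChainAmong ρ θ Pl ℓ U) (hUV : ∀ q ∈ Pl, plaqAction ρ q U = plaqAction ρ q V) :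
    HasBadChainAmong ρ θ Pl ℓ V := by
  obtain ⟨k, c, hin, hbad, hstep, hext⟩ := h
  exact ⟨k, c, hin, fun i => by rw [← hUV _ (hin i)]; exact hbad i, hstep, hext⟩

/-- `TypChain` is monotone: a larger tolerated extent or a larger badness threshold gives a larger class. -/
theorem typChain_mono {θ θ' : ℝ} {w : Fin 4 → ℤ → ℤ} {ℓ₀ ℓ₀' : ℕ} {c : Fin 4 → ℤ} (hθ : θ ≤ θ') (hℓ : ℓ₀ ≤ ℓ₀') :
    TypChain ρ θ w ℓ₀ c ⊆ TypChain ρ θ' w ℓ₀' c :=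
  fun _ hU h => hU (h.mono hθ hℓ)

end Chains

/-! ## §3 Cell-locality, measurability (`TypLocal`), calibration -/
section Bookkeeping

variable {G : Type} [Group G] {N : ℕ} (ρ : G →* Matrix (Fin N) (Fin N) ℂ)

/-- **`TypChain` is cell-local**: membership is read off the cell's own edges (every plaquette of `cellPlaqs w c` has its four
edges in `cellEdges w c`). -/
theorem typChain_dependsOn (θ : ℝ) (w : Fin 4 → ℤ → ℤ) (ℓ₀ : ℕ) (c : Fin 4 → ℤ) :
    DependsOn (fun σ : LGConfig 4 G => σ ∈ TypChain ρ θ w ℓ₀ c) ↑(cellEdges w c) := by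
  intro U V hUV
  have hq : ∀ q ∈ (↑(cellPlaqs w c) : Set (ZdPlaquette 4)), plaqAction ρ q U = plaqAction ρ q V := by
    intro q hq
    exact plaqAction_congr ρ q fun e he =>
      hUV e (Finset.mem_coe.2 (plaquetteEdges_subset_of_mem_cellPlaqs (Finset.mem_coe.1 hq) he))
  simp only [TypChain, Set.mem_setOf_eq]
  exact propext ⟨fun hU hV => hU (hV.congr fun q hq' => (hq q hq').symm), fun hV hU => hV (hU.congr hq)⟩

variable [TopologicalSpace G] [IsTopologicalGroup G] [MeasurableSpace G] [BorelSpace G] [SecondCountableTopology G]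

/-- **`TypChain` is measurable** (for continuous `ρ`): its complement is a countable union, over chain shapes, of finite
intersections of the closed events `θ ≤ plaqAction ρ q ·`. -/
theorem measurableSet_typChain (hρ : Continuous ρ) (θ : ℝ) (w : Fin 4 → ℤ → ℤ) (ℓ₀ : ℕ) (c : Fin 4 → ℤ) :
    MeasurableSet (TypChain ρ θ w ℓ₀ c) := by
  classical
  have hrepr : TypChain ρ θ w ℓ₀ c =
      (⋃ (k : ℕ), ⋃ (ch : Fin (k + 1) → ZdPlaquette 4),
        {U : LGConfig 4 G | (∀ i, ch i ∈ (↑(cellPlaqs w c) : Set (ZdPlaquette 4))) ∧ (∀ i, θ ≤ plaqAction ρ (ch i) U) ∧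
          (∀ i : Fin k, supNormZ4 ((ch i.castSucc).1 - (ch i.succ).1) ≤ 2) ∧
            ℓ₀ ≤ supNormZ4 ((ch 0).1 - (ch (Fin.last k)).1)})ᶜ := by
    ext U
    simp only [TypChain, HasBadChainAmong, Set.mem_setOf_eq, Set.mem_compl_iff, Set.mem_iUnion, not_exists]
  rw [hrepr]
  refine MeasurableSet.compl (MeasurableSet.iUnion fun k => MeasurableSet.iUnion fun ch => ?_)
  by_cases hA : (∀ i, ch i ∈ (↑(cellPlaqs w c) : Set (ZdPlaquette 4))) ∧
      (∀ i : Fin k, supNormZ4 ((ch i.castSucc).1 - (ch i.succ).1) ≤ 2) ∧ ℓ₀ ≤ supNormZ4 ((ch 0).1 - (ch (Fin.last k)).1)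
  · have hset : {U : LGConfig 4 G | (∀ i, ch i ∈ (↑(cellPlaqs w c) : Set (ZdPlaquette 4))) ∧
        (∀ i, θ ≤ plaqAction ρ (ch i) U) ∧ (∀ i : Fin k, supNormZ4 ((ch i.castSucc).1 - (ch i.succ).1) ≤ 2) ∧
          ℓ₀ ≤ supNormZ4 ((ch 0).1 - (ch (Fin.last k)).1)} = ⋂ i, {U | θ ≤ plaqAction ρ (ch i) U} := by
      ext U
      simp [hA]
    rw [hset]
    exact MeasurableSet.iInter fun i => measurableSet_le measurable_const (measurable_plaqAction ρ hρ _)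
  · have hset : {U : LGConfig 4 G | (∀ i, ch i ∈ (↑(cellPlaqs w c) : Set (ZdPlaquette 4))) ∧
        (∀ i, θ ≤ plaqAction ρ (ch i) U) ∧ (∀ i : Fin k, supNormZ4 ((ch i.castSucc).1 - (ch i.succ).1) ≤ 2) ∧
          ℓ₀ ≤ supNormZ4 ((ch 0).1 - (ch (Fin.last k)).1)} = ∅ := by
      ext U
      simp only [Set.mem_setOf_eq, Set.mem_empty_iff_false, iff_false]
      rintro ⟨h1, -, h3, h4⟩
      exact hA ⟨h1, h3, h4⟩
    rw [hset]
    exact MeasurableSet.empty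

omit [IsTopologicalGroup G] [BorelSpace G] [SecondCountableTopology G] in
/-- **`TypChain` is a `TypLocal` family** (the format's bookkeeping conjuncts), for continuous `ρ`. -/
theorem typLocal_typChain [IsTopologicalGroup G] [BorelSpace G] [SecondCountableTopology G] (hρ : Continuous ρ) (θ : ℝ)
    (w : Fin 4 → ℤ → ℤ) (ℓ₀ : ℕ) : TypLocal w (TypChain ρ θ w ℓ₀) :=
  ⟨fun c => measurableSet_typChain ρ hρ θ w ℓ₀ c, fun c => typChain_dependsOn ρ θ w ℓ₀ c⟩

omit [TopologicalSpace G] [IsTopologicalGroup G] [MeasurableSpace G] [BorelSpace G] [SecondCountableTopology G] in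
/-- Calibration: the trivial configuration has no bad plaquette at all for `θ > 0`, hence lies in every `TypChain`. -/
theorem one_mem_typChain {θ : ℝ} (hθ : 0 < θ) (w : Fin 4 → ℤ → ℤ) (ℓ₀ : ℕ) (c : Fin 4 → ℤ) :
    (1 : LGConfig 4 G) ∈ TypChain ρ θ w ℓ₀ c := by
  rintro ⟨k, ch, -, hbad, -, -⟩
  have h := hbad 0
  rw [plaqAction_one] at h
  exact absurd h (not_le.2 hθ)

end Bookkeeping

/-! ## §4 Loop erasure: a long chain contains an injective long chain -/
section LoopErasure

/-- **A long chain contains an injective long chain** (adapted from the tree's private `NonSimplyConnectedLatticeGap.exists_injective_chain`,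
`Theorems/ConvexGribovBodyNonSimplyConnectedLatticeGapStubLongBadChainsRareOfChessboard`).  If `c₀, …, c_k` satisfy `Q`, have `ℓ∞`-steps `≤ 2`
and end-to-end distance `≥ D`, then some INJECTIVE chain satisfies `Q`, has steps `≤ 2` and length `K` with `D ≤ 2K` (a chain of minimal length
with end-to-end distance `≥ D` has no repetition). -/
theorem exists_injective_chain {Q : ZdPlaquette 4 → Prop} {D k : ℕ} (c : Fin (k + 1) → ZdPlaquette 4)
    (hQ : ∀ i, Q (c i)) (hstep : ∀ i : Fin k, supNormZ4 ((c i.castSucc).1 - (c i.succ).1) ≤ 2)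
    (hlong : D ≤ supNormZ4 ((c 0).1 - (c (Fin.last k)).1)) :
    ∃ (K : ℕ) (c' : Fin (K + 1) → ZdPlaquette 4), Function.Injective c' ∧ (∀ i, Q (c' i)) ∧
      (∀ i : Fin K, supNormZ4 ((c' i.castSucc).1 - (c' i.succ).1) ≤ 2) ∧ D ≤ 2 * K := by
  classical
  let P : ℕ → (ℕ → ZdPlaquette 4) → Prop := fun K g =>
    (∀ n ≤ K, Q (g n)) ∧ (∀ n < K, supNormZ4 ((g n).1 - (g (n + 1)).1) ≤ 2) ∧ D ≤ supNormZ4 ((g 0).1 - (g K).1)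
  have hsplice : ∀ (K : ℕ) (g : ℕ → ZdPlaquette 4), P K g → ∀ i j : ℕ, i < j → j ≤ K → g i = g j →
      P (K - (j - i)) (fun n => if n ≤ i then g n else g (n + (j - i))) := by
    rintro K g ⟨h1, h2, h3⟩ i j hij hj he
    refine ⟨fun n hn => ?_, fun n hn => ?_, ?_⟩
    · dsimp only
      split_ifs with c1
      · exact h1 n (by omega)
      · exact h1 _ (by omega)
    · dsimp only
      by_cases c1 : n + 1 ≤ i
      · rw [if_pos (Nat.le_of_succ_le c1), if_pos c1]
        exact h2 n (by omega)
      by_cases c0 : n ≤ i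
      · rw [if_pos c0, if_neg c1]
        have hn : n = i := by omega
        have e1 : g n = g j := by rw [hn, he]
        rw [e1, show n + 1 + (j - i) = j + 1 by omega]
        exact h2 j (by omega)
      · rw [if_neg c0, if_neg c1, show n + 1 + (j - i) = n + (j - i) + 1 by omega]
        exact h2 _ (by omega)
    · dsimp only
      rw [if_pos (Nat.zero_le i)]
      split_ifs with c1
      · have hK : K - (j - i) = i := by omega
        have hjK : j = K := by omega
        rw [hK, he, hjK]
        exact h3
      · rw [Nat.sub_add_cancel (by omega : j - i ≤ K)]
        exact h3
  let f : ℕ → ZdPlaquette 4 := fun n => if h : n ≤ k then c ⟨n, Nat.lt_succ_of_le h⟩ else c 0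
  have hf : P k f := by
    refine ⟨fun n hn => ?_, fun n hn => ?_, ?_⟩
    · simp only [f, dif_pos hn]
      exact hQ _
    · simp only [f, dif_pos (Nat.le_of_lt hn), dif_pos (Nat.succ_le_of_lt hn)]
      exact hstep ⟨n, hn⟩
    · simp only [f, dif_pos (Nat.zero_le k), dif_pos (le_refl k)]
      exact hlong
  have hex : ∃ K, ∃ g : ℕ → ZdPlaquette 4, P K g := ⟨k, f, hf⟩
  obtain ⟨g, hg⟩ := Nat.find_spec hex
  have hdist : ∀ n ≤ Nat.find hex, supNormZ4 ((g 0).1 - (g n).1) ≤ 2 * n := by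
    intro n
    induction n with
    | zero => exact fun _ => supNormZ4_le_iff.2 fun i => by simp
    | succ n ih =>
      intro hn
      have e1 := ih (Nat.le_of_succ_le hn)
      have e2 := hg.2.1 n (Nat.lt_of_succ_le hn)
      have e3 := supNormZ4_sub_le (g 0).1 (g n).1 (g (n + 1)).1
      omega
  refine ⟨Nat.find hex, fun i => g i, ?_, fun i => hg.1 i (Nat.le_of_lt_succ i.2), fun i => hg.2.1 i i.2,
    hg.2.2.trans (hdist _ le_rfl)⟩
  intro s t hst
  by_contra hne
  have hs := s.2
  have ht := t.2
  rcases Nat.lt_or_gt_of_ne (fun e => hne (Fin.ext e)) with hlt | hlt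
  · exact Nat.find_min hex (show Nat.find hex - (t - s) < Nat.find hex by omega)
      ⟨_, hsplice _ g hg s t hlt (by omega) hst⟩
  · exact Nat.find_min hex (show Nat.find hex - (s - t) < Nat.find hex by omega)
      ⟨_, hsplice _ g hg t s hlt (by omega) hst.symm⟩

end LoopErasure

/-! ## §5 THE CHECK: `TypChain` is insertion tolerant -/
section Check

variable {G : Type} [Group G] {N : ℕ} (ρ : G →* Matrix (Fin N) (Fin N) ℂ)

/-- An edge of a plaquette has its base point within `ℓ∞`-distance `1` of the plaquette's base point. -/
theorem abs_sub_le_one_of_mem_plaquetteEdges {q : ZdPlaquette 4} {e : ZdEdge 4} (he : e ∈ plaquetteEdges q) (i : Fin 4) :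
    |e.1 i - q.1 i| ≤ 1 := by
  simp only [plaquetteEdges, Finset.mem_insert, Finset.mem_singleton] at he
  rcases he with rfl | rfl | rfl | rfl
  · simp
  · simp only [Pi.add_apply, Pi.single_apply]
    split_ifs <;> simp
  · simp only [Pi.add_apply, Pi.single_apply]
    split_ifs <;> simp
  · simp

/-- The base edge of a plaquette is one of its edges. -/
theorem base_mem_plaquetteEdges (q : ZdPlaquette 4) : ((q.1, q.2.1.1) : ZdEdge 4) ∈ plaquetteEdges q := by
  simp [plaquetteEdges]

/-- A plaquette untouched by `P` has the same action in `U` and in any `V` agreeing with `U` off `P`. -/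
theorem plaqAction_eq_of_not_touching {P : Finset (ZdEdge 4)} {U V : LGConfig 4 G} (hV : ∀ e, e ∉ P → V e = U e)
    {q : ZdPlaquette 4} (hq : ¬ (plaquetteEdges q ∩ P).Nonempty) : plaqAction ρ q V = plaqAction ρ q U :=
  plaqAction_congr ρ q fun e he => hV e fun heP => hq ⟨e, Finset.mem_inter.2 ⟨he, heP⟩⟩

/-- **Guard geometry.**  If the cell plaquette `q'` has its base point within `ℓ∞`-distance `2` of the base point of a plaquette `q`
touching `P`, then `q'` touches `nearLinks w c P R` for any `R ≥ 3` (its base edge is a cell edge within `3` of a link of `P`). -/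
theorem mem_guard_of_near_touching {w : Fin 4 → ℤ → ℤ} {c : Fin 4 → ℤ} {P : Finset (ZdEdge 4)} {R : ℕ} (hR : 3 ≤ R)
    {q q' : ZdPlaquette 4} (hq : (plaquetteEdges q ∩ P).Nonempty) (hq' : q' ∈ cellPlaqs w c)
    (hd : supNormZ4 (q.1 - q'.1) ≤ 2) : q' ∈ plaquettesTouching (nearLinks w c P R) := by
  classical
  obtain ⟨e, he⟩ := hq
  obtain ⟨heq, heP⟩ := Finset.mem_inter.1 he
  rw [mem_plaquettesTouching_iff]
  refine ⟨(q'.1, q'.2.1.1), Finset.mem_inter.2 ⟨base_mem_plaquetteEdges q', ?_⟩⟩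
  unfold nearLinks
  refine Finset.mem_filter.2 ⟨plaquetteEdges_subset_of_mem_cellPlaqs hq' (base_mem_plaquetteEdges q'), e, heP, fun k => ?_⟩
  have h1 : |e.1 k - q.1 k| ≤ 1 := abs_sub_le_one_of_mem_plaquetteEdges heq k
  have h2 : |q.1 k - q'.1 k| ≤ 2 := (supNormZ4_sub_le_iff_abs.1 hd) k
  have hR' : (3 : ℤ) ≤ (R : ℤ) := by exact_mod_cast hR
  rw [abs_le] at h1 h2 ⊢
  constructor <;> linarith [h1.1, h1.2, h2.1, h2.2]

/-- **THE CHECK (PROVED).**  For a guard threshold below the badness threshold (`θg < θb`), a guard radius `R ≥ 3` and a tolerated extent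
`ℓ₀ ≥ 60·ℓ₁`, the short-chain class `TypChain ρ θb w ℓ₀` is `(θg, R, ℓ₁)`-insertion tolerant (`SharpLanes.InsertionTolerant`, R109's
reading of record) on every frame `w`. -/
theorem insertionTolerant_typChain {θg θb : ℝ} (hθ : θg < θb) (w : Fin 4 → ℤ → ℤ) {R ℓ₀ ℓ₁ : ℕ} (hR : 3 ≤ R)
    (hℓ : 60 * ℓ₁ ≤ ℓ₀) : InsertionTolerant ρ w θg R ℓ₁ (TypChain ρ θb w ℓ₀) := by
  classical
  intro c₀ U hU P hP hcard hclean V hV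
  rintro ⟨k, ch, hin, hbad, hstep, hext⟩
  let touches : Fin (k + 1) → Prop := fun i => (plaquetteEdges (ch i) ∩ P).Nonempty
  have hin' : ∀ i, ch i ∈ cellPlaqs w c₀ := fun i => Finset.mem_coe.1 (hin i)
  -- propagation along one step (either direction): a touching plaquette forces its `2`-neighbour in the chain to touch
  have hprop : ∀ i j : Fin (k + 1), touches i → supNormZ4 ((ch i).1 - (ch j).1) ≤ 2 → touches j := by
    intro i j hi hd
    by_contra hj
    have hguard : ch j ∈ plaquettesTouching (nearLinks w c₀ P R) := mem_guard_of_near_touching hR hi (hin' j) hd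
    have h1 : plaqAction ρ (ch j) U ≤ θg := hclean _ hguard
    have h2 : plaqAction ρ (ch j) V = plaqAction ρ (ch j) U := plaqAction_eq_of_not_touching ρ hV hj
    have h3 : θb ≤ plaqAction ρ (ch j) V := hbad j
    rw [h2] at h3
    exact absurd (h3.trans h1) (not_le.2 hθ)
  by_cases hex : ∃ i, touches i
  · -- all chain plaquettes touch `P`
    obtain ⟨i₀, hi₀⟩ := hex
    have hdown : ∀ d : ℕ, ∀ i : Fin (k + 1), i.val + d = i₀.val → touches i := by
      intro d
      induction d with
      | zero =>
        intro i hi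
        have : i = i₀ := Fin.ext (by omega)
        rw [this]; exact hi₀
      | succ d ih =>
        intro i hi
        have hlt : i.val < k := by omega
        have hj := ih ⟨i.val + 1, by omega⟩ (by simp only; omega)
        have hs := hstep ⟨i.val, hlt⟩
        have e1 : (⟨i.val, hlt⟩ : Fin k).castSucc = i := Fin.ext rfl
        have e2 : (⟨i.val, hlt⟩ : Fin k).succ = ⟨i.val + 1, by omega⟩ := Fin.ext rfl
        rw [e1, e2] at hs
        rw [supNormZ4_sub_comm] at hs
        exact hprop _ _ hj hs
    have h0 : touches 0 := hdown i₀.val 0 (by simp)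
    have hall : ∀ n : ℕ, ∀ i : Fin (k + 1), i.val = n → touches i := by
      intro n
      induction n with
      | zero => intro i hi; have : i = 0 := Fin.ext hi; rw [this]; exact h0
      | succ n ih =>
        intro i hi
        have hlt : n < k := by omega
        have hprev := ih ⟨n, by omega⟩ rfl
        have hs := hstep ⟨n, hlt⟩
        have e1 : (⟨n, hlt⟩ : Fin k).castSucc = ⟨n, by omega⟩ := Fin.ext rfl
        have e2 : (⟨n, hlt⟩ : Fin k).succ = i := Fin.ext (by simp [hi])
        rw [e1, e2] at hs
        exact hprop _ _ hprev hs
    have htouch : ∀ i, ch i ∈ plaquettesTouching P := fun i =>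
      mem_plaquettesTouching_iff.2 (hall i.val i rfl)
    obtain ⟨K, c', hinj, hQ, -, hD⟩ := exists_injective_chain (Q := fun q => q ∈ plaquettesTouching P) ch htouch hstep hext
    have hcardK : K + 1 ≤ (plaquettesTouching P).card := by
      have hi : Function.Injective (fun i : Fin (K + 1) => (⟨c' i, hQ i⟩ : ↥(plaquettesTouching P))) :=
        fun s t hst => hinj (by simpa using congrArg Subtype.val hst)
      have := Fintype.card_le_of_injective _ hi
      simpa [Fintype.card_coe] using this
    have h30 : (plaquettesTouching P).card ≤ 30 * P.card := by
      have h := Literature.MathematicalPhysics.QuantumLattice.card_plaquettesTouching_le P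
      have h6 : Fintype.card {p : Fin 4 × Fin 4 // p.1 < p.2} = 6 := by decide
      rw [h6] at h
      omega
    have : 30 * P.card ≤ 30 * ℓ₁ := Nat.mul_le_mul_left _ hcard
    omega
  · -- no chain plaquette touches `P`: the chain is bad in `U` already
    simp only [not_exists] at hex
    refine hU ⟨k, ch, hin, fun i => ?_, hstep, hext⟩
    rw [← plaqAction_eq_of_not_touching ρ hV (hex i)]
    exact hbad i

end Check

end Summit.QuantumFields.YangMills.Cruxes.IR.AfPincerUc.SharpLanes

end
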